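import Summits.NavierStokesRegularity.NavierStokesRegularity.Theorems.EfficiencyFloorNearSaturationNearMaximiserSeqCoreWeakCurl
import HarnessLib

/-!
# Route `EfficiencyFloor`, crux `NearSaturationNearMaximiser` (stmt-NavierStokesRegularity-25482) on the
# `ProductionEfficiencyDecay` ladder (stmt-22866): LOCAL `L⁴` SMALLNESS OF THE VORTICITY DIFFERENCE (first brick of (c'-quad))

Def-free helper file, eighth of the group. The remaining clause (c'-quad) of (P_w''')
(`nearSaturationNearMaximiser_of_centredLocalGradientTestFieldLimit`, `…SeqCoreWeakCurl`) — the three QUADRATIC mixed trilinear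
stretching terms of `(r_k, w)`, `r_k = v_{φk} − w`, tend to zero — splits into a BALL part, controlled by `‖curl r_k‖_{L⁴(B(0,R))}`, and a
TAIL part, controlled by `‖curl w‖_{L⁴(B(0,R)ᶜ)} + ‖Dw‖_{L²(B(0,R)ᶜ)}`. This file proves the engine of the ball part:

* `setIntegral_norm_pow_four_le` — interpolation on a set: `∫_s ‖f‖⁴ ≤ √(∫_s ‖f‖²) · √(∫ ‖f‖⁶)` (Cauchy–Schwarz on `volume.restrict s`);
* `integral_curl_pow_six_le_palinstrophy` — `∫‖curl v‖⁶ ≤ (K √Pal(v))⁶` for admissible `v` (the tree's whole-space `H¹ ⊂ L⁶`,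
  `integral_norm_pow_six_le_of_integrable`, applied to `curl v`);
* `tendsto_setIntegral_curl_pow_four` — along admissible `u_k` with `Pal(u_k) ≤ M_P` and an admissible `w`: if
  `∫_s ‖curl (u_k − w)‖² → 0` then `∫_s ‖curl (u_k − w)‖⁴ → 0`.

HONEST FRAMING: (c'-quad), (P_w'''), stmt-25482, `LerayFloorGap`, `ProductionEfficiencyDecay` (stmt-22866) and Navier–Stokes regularity
stay OPEN; no summit statement is proved. [folklore]
-/

-- the problem directory repeats the summit name (`NavierStokesRegularity/NavierStokesRegularity`)
set_option linter.dupNamespace false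

noncomputable section

namespace Summit.NavierStokesRegularity.NavierStokesRegularity.Theorems

namespace NearSaturationNearMaximiser

namespace SeqCore

open Set MeasureTheory Filter Topology Function
open scoped InnerProductSpace ENNReal NNReal
open Literature.Analysis.FluidPDE
open Magsanop2026Enstrophy (slice_integrable)

/-! ## §1 Interpolation on a set: `L² ∩ L⁶ ⊂ L⁴` -/

/-- **Interpolation on a set**: for continuous `f` with `‖f‖², ‖f‖⁶ ∈ L¹` and any set `s`,
`‖f‖⁴` is integrable on `s` and `∫_s ‖f‖⁴ ≤ √(∫_s ‖f‖²) · √(∫ ‖f‖⁶)` (Cauchy–Schwarz `‖f‖⁴ = ‖f‖·‖f‖³` on `volume.restrict s`, any `s`,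
then `∫_s ‖f‖⁶ ≤ ∫ ‖f‖⁶`). [folklore] -/
theorem setIntegral_norm_pow_four_le {F : Type*} [NormedAddCommGroup F] {f : EuclideanSpace ℝ (Fin 3) → F} (hf : Continuous f)
    (h2 : Integrable (fun x => ‖f x‖ ^ 2)) (h6 : Integrable (fun x => ‖f x‖ ^ 6)) (s : Set (EuclideanSpace ℝ (Fin 3))) :
    IntegrableOn (fun x => ‖f x‖ ^ 4) s ∧
      ∫ x in s, ‖f x‖ ^ 4 ≤ Real.sqrt (∫ x in s, ‖f x‖ ^ 2) * Real.sqrt (∫ x, ‖f x‖ ^ 6) := by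
  -- `‖f‖⁴ ≤ ‖f‖² + ‖f‖⁶` gives integrability
  have I4 : Integrable (fun x => ‖f x‖ ^ 4) := by
    refine (h2.add h6).mono' (hf.norm.pow 4).aestronglyMeasurable (ae_of_all _ fun x => ?_)
    simp only [Pi.add_apply]
    rw [Real.norm_eq_abs, abs_of_nonneg (by positivity)]
    have h0 : 0 ≤ ‖f x‖ := norm_nonneg _
    nlinarith [mul_nonneg (sq_nonneg (‖f x‖ ^ 2 - 1)) (sq_nonneg ‖f x‖), pow_nonneg h0 2]
  refine ⟨I4.integrableOn, ?_⟩
  have hc3 : Continuous (fun x => ‖f x‖ ^ 3) := hf.norm.pow 3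
  have ma : MemLp (fun x => ‖f x‖) (ENNReal.ofReal 2) (volume.restrict s) := by
    rw [ENNReal.ofReal_ofNat]
    exact ((memLp_two_iff_integrable_sq_norm hf.norm.aestronglyMeasurable).2
      (h2.congr (ae_of_all _ fun x => by simp only [norm_norm]))).restrict s
  have mb : MemLp (fun x => ‖f x‖ ^ 3) (ENNReal.ofReal 2) (volume.restrict s) := by
    rw [ENNReal.ofReal_ofNat]
    exact ((memLp_two_iff_integrable_sq_norm hc3.aestronglyMeasurable).2
      (h6.congr (ae_of_all _ fun x => by
        show ‖f x‖ ^ 6 = ‖‖f x‖ ^ 3‖ ^ 2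
        rw [Real.norm_of_nonneg (pow_nonneg (norm_nonneg _) 3)]; ring))).restrict s
  have hH := integral_mul_le_Lp_mul_Lq_of_nonneg (μ := volume.restrict s) Real.HolderConjugate.two_two
    (f := fun x => ‖f x‖) (g := fun x => ‖f x‖ ^ 3) (ae_of_all _ fun x => norm_nonneg _)
    (ae_of_all _ fun x => pow_nonneg (norm_nonneg _) 3) ma mb
  have e1 : ∫ x in s, ‖f x‖ * ‖f x‖ ^ 3 = ∫ x in s, ‖f x‖ ^ 4 :=
    integral_congr_ae (ae_of_all _ fun x => by simp only; ring)
  have e2 : ∫ x in s, ‖f x‖ ^ (2 : ℝ) = ∫ x in s, ‖f x‖ ^ 2 :=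
    integral_congr_ae (ae_of_all _ fun x => by simp only [Real.rpow_two])
  have e3 : ∫ x in s, (‖f x‖ ^ 3) ^ (2 : ℝ) = ∫ x in s, ‖f x‖ ^ 6 :=
    integral_congr_ae (ae_of_all _ fun x => by simp only [Real.rpow_two]; ring)
  rw [e1, e2, e3] at hH
  have e4 : ∀ y : ℝ, y ^ (1 / (2 : ℝ)) = Real.sqrt y := fun y => by rw [Real.sqrt_eq_rpow]
  simp only [e4] at hH
  refine hH.trans (mul_le_mul_of_nonneg_left (Real.sqrt_le_sqrt ?_) (Real.sqrt_nonneg _))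
  exact setIntegral_le_integral h6 (ae_of_all _ fun x => by positivity)

/-! ## §2 The `L⁶` bound of the vorticity by the palinstrophy -/

/-- **`H¹ ⊂ L⁶` for the vorticity of an admissible field**: `∫‖curl v‖⁶ ≤ (K · √Pal(v))⁶`, `K` = Mathlib's Sobolev constant
(`‖D curl v(x)‖² ≤ |D curl v(x)|²_F`). [cite: Evans2010, §5.6.1 Thm. 1–2] -/
theorem integral_curl_pow_six_le_palinstrophy {v : EuclideanSpace ℝ (Fin 3) → EuclideanSpace ℝ (Fin 3)} (hv : ContDiff ℝ (⊤ : ℕ∞) v)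
    (h1 : ∫⁻ x, ‖iteratedFDeriv ℝ 1 v x‖ₑ ^ 2 < ⊤) (h2 : ∫⁻ x, ‖iteratedFDeriv ℝ 2 v x‖ₑ ^ 2 < ⊤) :
    Integrable (fun x => ‖curl v x‖ ^ 6) ∧
      ∫ x, ‖curl v x‖ ^ 6 ≤ ((SNormLESNormFDerivOfEqConst (EuclideanSpace ℝ (Fin 3))
        (volume : Measure (EuclideanSpace ℝ (Fin 3))) 2 : ℝ) * Real.sqrt (∫ x, frobeniusNormSq (fderiv ℝ (curl v) x))) ^ 6 := by
  have hv3 : ContDiff ℝ 3 v := hv.of_le (by norm_cast)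
  obtain ⟨I2, ID, IF, I6, -⟩ := slice_integrable hv3 h1 h2
  have hω1 : ContDiff ℝ 1 (curl v) := contDiff_curl (n := 1) (hv.of_le (by norm_cast))
  refine ⟨I6, ?_⟩
  have h := integral_norm_pow_six_le_of_integrable (volume : Measure (EuclideanSpace ℝ (Fin 3))) finrank_euclideanSpace_fin
    hω1 I2 I6 ID
  refine h.trans (pow_le_pow_left₀ (mul_nonneg (NNReal.coe_nonneg _) (Real.sqrt_nonneg _)) ?_ 6)
  exact mul_le_mul_of_nonneg_left (Real.sqrt_le_sqrt (integral_mono ID IF fun x => norm_sq_le_frobeniusNormSq _))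
    (NNReal.coe_nonneg _)

/-! ## §3 Local `L⁴` smallness of the vorticity difference -/

/-- **Local `L²` smallness upgrades to local `L⁴` smallness.** Along admissible `u_k` with `Pal(u_k) ≤ M_P` and an admissible `w`,
on any set `s`: if `∫_s ‖curl (u_k − w)‖² → 0` then `∫_s ‖curl (u_k − w)‖⁴ → 0` (interpolation with the uniform `L⁶` bound
`∫‖curl (u_k − w)‖⁶ ≤ (K √(2M_P + 2Pal(w)))⁶`). This is the engine of the BALL part of the quadratic mixed terms. [folklore] -/
theorem tendsto_setIntegral_curl_pow_four {u : ℕ → EuclideanSpace ℝ (Fin 3) → EuclideanSpace ℝ (Fin 3)}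
    {w : EuclideanSpace ℝ (Fin 3) → EuclideanSpace ℝ (Fin 3)} {MP : ℝ}
    (hu : ∀ k, ContDiff ℝ (⊤ : ℕ∞) (u k) ∧ VectorCalculus.IsDivFree (u k) ∧ (∫⁻ x, ‖iteratedFDeriv ℝ 0 (u k) x‖ₑ ^ 2 < ⊤) ∧
      (∫⁻ x, ‖iteratedFDeriv ℝ 1 (u k) x‖ₑ ^ 2 < ⊤) ∧ (∫⁻ x, ‖iteratedFDeriv ℝ 2 (u k) x‖ₑ ^ 2 < ⊤))
    (hw : ContDiff ℝ (⊤ : ℕ∞) w ∧ VectorCalculus.IsDivFree w ∧ (∫⁻ x, ‖iteratedFDeriv ℝ 0 w x‖ₑ ^ 2 < ⊤) ∧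
      (∫⁻ x, ‖iteratedFDeriv ℝ 1 w x‖ₑ ^ 2 < ⊤) ∧ (∫⁻ x, ‖iteratedFDeriv ℝ 2 w x‖ₑ ^ 2 < ⊤))
    (hP : ∀ k, ∫ x, frobeniusNormSq (fderiv ℝ (curl (u k)) x) ≤ MP)
    {s : Set (EuclideanSpace ℝ (Fin 3))}
    (hloc : Tendsto (fun k => ∫ x in s, ‖curl (u k - w) x‖ ^ 2) atTop (𝓝 0)) :
    Tendsto (fun k => ∫ x in s, ‖curl (u k - w) x‖ ^ 4) atTop (𝓝 0) := by
  have hr := fun k => admissible_sub (hu k) hw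
  set CP : ℝ := 2 * MP + 2 * ∫ x, frobeniusNormSq (fderiv ℝ (curl w) x) with hCP
  have hPr : ∀ k, ∫ x, frobeniusNormSq (fderiv ℝ (curl (u k - w)) x) ≤ CP := fun k =>
    (palinstrophy_sub_le (hu k).1 hw.1 (hu k).2.2.2.2 hw.2.2.2.2).trans (by linarith [hP k])
  set K : ℝ := (SNormLESNormFDerivOfEqConst (EuclideanSpace ℝ (Fin 3)) (volume : Measure (EuclideanSpace ℝ (Fin 3))) 2 : ℝ)
    with hK
  have hK0 : 0 ≤ K := NNReal.coe_nonneg _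
  set C6 : ℝ := (K * Real.sqrt CP) ^ 6 with hC6
  -- the uniform `L⁶` bound and the interpolation bound
  have hbd : ∀ k, ∫ x in s, ‖curl (u k - w) x‖ ^ 4 ≤ Real.sqrt (∫ x in s, ‖curl (u k - w) x‖ ^ 2) * Real.sqrt C6 := by
    intro k
    have hc3 : ContDiff ℝ 3 (u k - w) := (hr k).1.of_le (by norm_cast)
    obtain ⟨I2, -, -, I6, -⟩ := slice_integrable hc3 (hr k).2.2.2.1 (hr k).2.2.2.2
    have hωc : Continuous (curl (u k - w)) := (contDiff_curl (n := 1) ((hr k).1.of_le (by norm_cast))).continuous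
    obtain ⟨-, hle⟩ := setIntegral_norm_pow_four_le hωc I2 I6 s
    obtain ⟨-, h6⟩ := integral_curl_pow_six_le_palinstrophy (hr k).1 (hr k).2.2.2.1 (hr k).2.2.2.2
    refine hle.trans (mul_le_mul_of_nonneg_left (Real.sqrt_le_sqrt (h6.trans ?_)) (Real.sqrt_nonneg _))
    rw [hC6]
    exact pow_le_pow_left₀ (mul_nonneg hK0 (Real.sqrt_nonneg _)) (mul_le_mul_of_nonneg_left (Real.sqrt_le_sqrt (hPr k)) hK0) 6
  -- squeeze
  have h0 : ∀ k, 0 ≤ ∫ x in s, ‖curl (u k - w) x‖ ^ 4 := fun k => integral_nonneg fun x => by positivity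
  have hup : Tendsto (fun k => Real.sqrt (∫ x in s, ‖curl (u k - w) x‖ ^ 2) * Real.sqrt C6) atTop (𝓝 0) := by
    have h := ((Real.continuous_sqrt.tendsto 0).comp hloc).mul_const (Real.sqrt C6)
    rwa [Real.sqrt_zero, zero_mul] at h
  exact tendsto_of_tendsto_of_tendsto_of_le_of_le tendsto_const_nhds hup h0 hbd

end SeqCore

end NearSaturationNearMaximiser

end Summit.NavierStokesRegularity.NavierStokesRegularity.Theorems

end
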